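import Mathlib
import HarnessLib
import Literature.Analysis.Calculus.FunctionalDependence
import Summits.NavierStokesRegularity.NavierStokesRegularity.Theorems.PoloidalWindowDoorPoloidalWindowRigidityClebsch
import Summits.NavierStokesRegularity.NavierStokesRegularity.Theorems.PoloidalWindowDoorPoloidalWindowRigidityFirstIntegral

/-!
# Route `PoloidalWindowDoor`, crux `PoloidalWindowRigidity` (K2, stmt-NavierStokesRegularity-19708) —
# THE LOCAL STRUCTURE FUNCTION OF A POLOIDAL PROFILE: `v₂ = F(t, ψ, x₂)` near every vortical point

Cell ns-regularity-ideate, seat ns-poloidal-K2-p3 gen 5 (stub-worker; file landed `--supports stmt-NavierStokesRegularity-19708`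
as a helper).  The structural route to the one open stub `stub_lrcModEntire` of line «lrc-jet» (K2 lead's CENSUS-K2-g4 §4(a);
K2P1-LOCAL-NOTES §1, the pressure-free normal form {T0, Dyn}) starts from the STRUCTURE FUNCTION of a poloidal flow: with
Clebsch variables `v = ∇φ + ψ e₂`, `ω = ∇ψ × e₂` (tree `…Clebsch.exists_clebsch_uncurry`) the frozen constraint
`{ψ, v₂}_h = 0` (tree `…Clebsch.frozen_bracket`, nsreg-p6's `stub_firstIntegral`) says that `∇_h v₂ ∥ ∇_h ψ`, and
K2P1-LOCAL-NOTES §1(d) reads this as "locally where `∇_h ψ ≠ 0`, `v₂ = F(ψ, x₂, t)`" — the object whose `q`-derivative is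
the Clebsch slope `Λ` and whose jets `a_j` are the free parameters of nsreg-p7's slice tower / ns-poloidal-K2-cert-1's jet
scheme.  This file supplies that existential step in the kernel, from the functional dependence theorem
`Literature.Analysis.Calculus.exists_comp_spaceTime` (Zorich I §8.6.3 Prop. 1 with parameters, `Cⁿ` inverse function
theorem):

* `fderiv_uncurry_zero_dir`, `fderiv_uncurry_apply_two_zero_dir` — bookkeeping: slice partials of `ψ` and of `v₂` are the
  space–time partials in the directions `(0, e_b)`;
* `exists_verticalVelocity_eq_structureFunction` — **class + poloidal, `ψ` any `Cⁿ` space–time function carrying the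
  vorticity as `ω = (∂₁ψ, −∂₀ψ, 0)` on every slice, `ω(t₀,y₀) ≠ 0` ⇒ `∃ F : ℝ × ℝ × ℝ → ℝ`, `Cⁿ` at
  `(t₀, ψ(t₀,y₀), (y₀)₂)`, with `v₂(t,y) = F(t, ψ(t,y), y₂)` for all `(t,y)` near `(t₀,y₀)`**;
* `exists_clebsch_eq_structureFunction` — the transposed form near a point with `∇_h v₂ ≠ 0`: `ψ(t,y) = F̃(t, v₂(t,y), y₂)`;
* `exists_clebsch_eq_structureFunction_q` — the `q`-COORDINATES of K2P1-LOCAL-NOTES §1(e): near a point with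
  `∂_b(v₂ − ψ) ≠ 0` (`= ∂₂v_b ≠ 0` for the Clebsch pair, the stub's non-degeneracy), `ψ = A₁(t, q, y₂)` with
  `q = v₂ − ψ = ∂₂φ`, so `v = (∂₀φ, ∂₁φ, q + A₁(t, q, x₂))`;
* `exists_clebsch_structureFunction` — packaged with the tree's jointly smooth Clebsch pair: for every profile of the
  class, poloidal along `e₃`, there are `φ, ψ` (jointly `C^∞` on the slab, `v = ∇φ + ψe₂`, `ω = ∇ψ × e₂`, (E1)) such that
  near EVERY vortical point of the slab `v₂ = F(t, ψ, x₂)` with `F` of class `C^∞` there.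

WHAT THIS IS NOT: not a claim about Navier–Stokes regularity, not LRC″ and not the normal form {T0, Dyn} itself (the
`q`-coordinates and the Dyn equation are the next bricks) — the existential "structure function" step of the structural
route (bears_on LADDER-NS N0 via crux K2 = stmt-19708).
-/

noncomputable section

-- the summit and its single sub-problem share the name (CONVENTIONS §1), as in every Theorems file
set_option linter.dupNamespace false

namespace Summit.NavierStokesRegularity.NavierStokesRegularity.Theorems.PoloidalWindowDoorPoloidalWindowRigidityStructureFunction

open Set Function Filter Topology Metric
open scoped RealInnerProductSpace InnerProductSpace Laplacian ContDiff
open Literature.Analysis Literature.Analysis.FluidPDE Literature.Analysis.Calculus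
open Summit.NavierStokesRegularity.NavierStokesRegularity.Theorems.LocalSineTubeDoorProfileAlignedWindowRigidityAncient
open Summit.NavierStokesRegularity.NavierStokesRegularity.Theorems.PoloidalWindowDoorPoloidalWindowRigidityClebsch
open Summit.NavierStokesRegularity.NavierStokesRegularity.Theorems.PoloidalWindowDoorPoloidalWindowRigidityFirstIntegral

variable {C : ℝ} {v : ℝ → EuclideanSpace ℝ (Fin 3) → EuclideanSpace ℝ (Fin 3)}

/-! ### Slice partials as space–time partials -/

/-- The horizontal/vertical slice partials of a scalar space–time function are its space–time partials in the
directions `(0, e)`: `D(uncurry ψ)(t,y)(0,e) = D(ψ t)(y) e`. -/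
theorem fderiv_uncurry_zero_dir {ψ : ℝ → EuclideanSpace ℝ (Fin 3) → ℝ} {t : ℝ} {y : EuclideanSpace ℝ (Fin 3)}
    (h : DifferentiableAt ℝ (uncurry ψ) (t, y)) (e : EuclideanSpace ℝ (Fin 3)) :
    fderiv ℝ (uncurry ψ) (t, y) ((0 : ℝ), e) = fderiv ℝ (ψ t) y e := by
  have hc := (h.hasFDerivAt.comp y (hasFDerivAt_prodMk_right t y)).fderiv
  have e1 : (uncurry ψ ∘ fun y' : EuclideanSpace ℝ (Fin 3) => (t, y')) = ψ t := by
    funext y'; rfl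
  rw [e1] at hc
  rw [hc, ContinuousLinearMap.comp_apply, ContinuousLinearMap.inr_apply]

/-- The same for the vertical velocity `(t,y) ↦ v t y 2` of a space–time field differentiable at `(t,y)`:
`D((t,y) ↦ v₂)(t,y)(0,e) = (D(v t)(y) e)₂`. -/
theorem fderiv_uncurry_apply_two_zero_dir {t : ℝ} {y : EuclideanSpace ℝ (Fin 3)}
    (h : DifferentiableAt ℝ (uncurry v) (t, y)) (e : EuclideanSpace ℝ (Fin 3)) :
    fderiv ℝ (fun p : ℝ × EuclideanSpace ℝ (Fin 3) => v p.1 p.2 2) (t, y) ((0 : ℝ), e) = fderiv ℝ (v t) y e 2 := by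
  have hproj : (fun p : ℝ × EuclideanSpace ℝ (Fin 3) => v p.1 p.2 2) =
      (EuclideanSpace.proj (2 : Fin 3) : EuclideanSpace ℝ (Fin 3) →L[ℝ] ℝ) ∘ uncurry v := by
    funext p; rfl
  rw [hproj, ((EuclideanSpace.proj (2 : Fin 3) : EuclideanSpace ℝ (Fin 3) →L[ℝ] ℝ).hasFDerivAt.comp (t, y)
    h.hasFDerivAt).fderiv, ContinuousLinearMap.comp_apply]
  have hc := (h.hasFDerivAt.comp y (hasFDerivAt_prodMk_right t y)).fderiv
  have e1 : (uncurry v ∘ fun y' : EuclideanSpace ℝ (Fin 3) => (t, y')) = v t := by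
    funext y'; rfl
  rw [e1] at hc
  rw [hc]
  rfl

/-! ### The structure function of a poloidal profile near a vortical point -/

/-- **LOCAL STRUCTURE FUNCTION `v₂ = F(t, ψ, x₂)` (K2P1-LOCAL-NOTES §1(d): "locally where `∇_h W ≠ 0`,
`v₃ = F(W, x₃, t)`").**  Let `v` be a profile of the route's Type-I class (Type-I time decay, continuous on the slab,
unit-viscosity Oseen-mild, divergence-free slices), poloidal along `e₃`, and let `ψ : ℝ → ℝ³ → ℝ` carry the vorticity
of every slice as `curl (v t) = ∇(ψ t) × e₂` (coordinates `(curl v)₀ = ∂₁ψ`, `(curl v)₁ = −∂₀ψ`; e.g. the Clebsch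
stream function of `…Clebsch.exists_clebsch_uncurry`), with `uncurry ψ` of class `Cⁿ` at `(t₀, y₀)` (`n ≠ 0`,
`t₀ < 0`).  If the vorticity does not vanish at `(t₀, y₀)`, then there is a STRUCTURE FUNCTION `F : ℝ × ℝ × ℝ → ℝ` of
class `Cⁿ` at `(t₀, ψ t₀ y₀, (y₀)₂)` with `v t y 2 = F (t, ψ t y, y₂)` for all `(t, y)` near `(t₀, y₀)`: on each
horizontal plane of each slice the vertical velocity is a function of the stream function (the frozen constraint
`{ψ, v₂}_h = 0`, tree `frozen_bracket` + `stub_firstIntegral`, integrated by the functional dependence theorem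
`Literature.Analysis.Calculus.exists_comp_spaceTime`). -/
theorem exists_verticalVelocity_eq_structureFunction {n : WithTop ℕ∞} (hn : n ≠ 0)
    (hrate : HasTypeITimeDecay C v)
    (hcont : ContinuousOn (uncurry v) (Iio (0 : ℝ) ×ˢ univ))
    (hmild : ∀ s t : ℝ, s < t → t < 0 → ∀ x,
      v t x = UnboundedOperators.heatExtension (v s) (t - s) x - oseenDuhamel 1 s v v t x)
    (hdiv : ∀ t < 0, VectorCalculus.IsDivFree (v t))
    (hpol : ∀ s < 0, ∀ y, ⟪curl (v s) y, EuclideanSpace.single 2 1⟫_ℝ = 0)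
    {ψ : ℝ → EuclideanSpace ℝ (Fin 3) → ℝ} {t₀ : ℝ} {y₀ : EuclideanSpace ℝ (Fin 3)} (ht₀ : t₀ < 0)
    (hψ : ContDiffAt ℝ n (uncurry ψ) (t₀, y₀))
    (hω : ∀ t < 0, ∀ y, curl (v t) y 0 = fderiv ℝ (ψ t) y (EuclideanSpace.single 1 1) ∧
      curl (v t) y 1 = -fderiv ℝ (ψ t) y (EuclideanSpace.single 0 1))
    (hne : curl (v t₀) y₀ ≠ 0) :
    ∃ F : ℝ × ℝ × ℝ → ℝ, ContDiffAt ℝ n F (t₀, ψ t₀ y₀, y₀ 2) ∧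
      ∀ᶠ z in 𝓝 (t₀, y₀), v z.1 z.2 2 = F (z.1, ψ z.1 z.2, z.2 2) := by
  have hn1 : (1 : WithTop ℕ∞) ≤ n := ENat.one_le_iff_ne_zero_withTop.mpr hn
  -- joint analyticity of `v` on the slab ⇒ `f := v₂` is `Cⁿ` at `(t₀,y₀)` and differentiable nearby
  have hanV := analyticOnNhd_uncurry hcont (bdd_of_hasTypeITimeDecay hrate) hmild
  have hmem : (t₀, y₀) ∈ Iio (0 : ℝ) ×ˢ (univ : Set (EuclideanSpace ℝ (Fin 3))) :=
    mem_prod.2 ⟨show t₀ < 0 from ht₀, mem_univ _⟩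
  have hslab : Iio (0 : ℝ) ×ˢ (univ : Set (EuclideanSpace ℝ (Fin 3))) ∈ 𝓝 (t₀, y₀) :=
    (isOpen_Iio.prod isOpen_univ).mem_nhds hmem
  set f : ℝ × EuclideanSpace ℝ (Fin 3) → ℝ := fun p => v p.1 p.2 2 with hf
  have hfc : ContDiffAt ℝ n f (t₀, y₀) := by
    have h1 : ContDiffAt ℝ n (uncurry v) (t₀, y₀) := (hanV _ hmem).contDiffAt
    exact ((EuclideanSpace.proj (2 : Fin 3) : EuclideanSpace ℝ (Fin 3) →L[ℝ] ℝ).contDiff.contDiffAt).comp _ h1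
  -- the pin: `ω ≠ 0` ⇒ `∂_{b₀} ψ ≠ 0` for a horizontal `b₀`
  have hω0 := hω t₀ ht₀ y₀
  have hω2 : curl (v t₀) y₀ 2 = 0 := by
    simpa [EuclideanSpace.inner_single_right] using hpol t₀ ht₀ y₀
  obtain ⟨b₀, b₁, hb₀, hb₁, hb, hpin0⟩ : ∃ b₀ b₁ : Fin 3, b₀ ≠ 2 ∧ b₁ ≠ 2 ∧ b₀ ≠ b₁ ∧
      fderiv ℝ (ψ t₀) y₀ (EuclideanSpace.single b₀ 1) ≠ 0 := by
    by_cases h0 : fderiv ℝ (ψ t₀) y₀ (EuclideanSpace.single 0 1) = 0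
    · by_cases h1 : fderiv ℝ (ψ t₀) y₀ (EuclideanSpace.single 1 1) = 0
      · exfalso
        apply hne
        ext i
        fin_cases i
        · simpa [hω0.1] using h1
        · simpa [hω0.2] using h0
        · simpa using hω2
      · exact ⟨1, 0, by decide, by decide, by decide, h1⟩
    · exact ⟨0, 1, by decide, by decide, by decide, h0⟩
  -- differentiability near `(t₀, y₀)`
  have hψd : ∀ᶠ z in 𝓝 (t₀, y₀), DifferentiableAt ℝ (uncurry ψ) z :=
    ((hψ.of_le hn1).eventually (by simp)).mono fun z hz => hz.differentiableAt one_ne_zero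
  have hvd : ∀ᶠ z in 𝓝 (t₀, y₀), DifferentiableAt ℝ (uncurry v) z ∧ z.1 < 0 := by
    filter_upwards [hslab] with z hz
    exact ⟨(hanV z hz).differentiableAt, (mem_prod.1 hz).1⟩
  -- the pin in space–time form
  have hpin : fderiv ℝ (uncurry ψ) (t₀, y₀) ((0 : ℝ), EuclideanSpace.single b₀ (1 : ℝ)) ≠ 0 := by
    rw [fderiv_uncurry_zero_dir (hψ.differentiableAt hn)]
    exact hpin0
  -- the bracket in space–time form, from the frozen constraint
  have hbr : ∀ᶠ z in 𝓝 (t₀, y₀),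
      fderiv ℝ f z ((0 : ℝ), EuclideanSpace.single b₀ (1 : ℝ)) *
          fderiv ℝ (uncurry ψ) z ((0 : ℝ), EuclideanSpace.single b₁ (1 : ℝ)) =
        fderiv ℝ f z ((0 : ℝ), EuclideanSpace.single b₁ (1 : ℝ)) *
          fderiv ℝ (uncurry ψ) z ((0 : ℝ), EuclideanSpace.single b₀ (1 : ℝ)) := by
    filter_upwards [hψd, hvd] with z hzψ hzv
    obtain ⟨t, y⟩ := z
    obtain ⟨hzv, ht⟩ := hzv
    rw [fderiv_uncurry_zero_dir hzψ, fderiv_uncurry_zero_dir hzψ, hf,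
      fderiv_uncurry_apply_two_zero_dir hzv, fderiv_uncurry_apply_two_zero_dir hzv]
    have hfro := frozen_bracket (v := v)
      (stub_firstIntegral C v hrate hcont hmild hdiv (EuclideanSpace.single 2 1) hpol t ht)
      (ψ := ψ t) (fun y' => ⟨(hω t ht y').1, (hω t ht y').2, by
        simpa [EuclideanSpace.inner_single_right] using hpol t ht y'⟩) y
    -- hfro : ∂₁ψ ∂₀v₂ − ∂₀ψ ∂₁v₂ = 0
    have hcases : (b₀ = 0 ∧ b₁ = 1) ∨ (b₀ = 1 ∧ b₁ = 0) := by
      revert hb₀ hb₁ hb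
      clear hpin hpin0
      revert b₀ b₁
      decide
    rcases hcases with ⟨rfl, rfl⟩ | ⟨rfl, rfl⟩
    · linarith
    · linarith
  obtain ⟨G, hGc, hGeq⟩ := exists_comp_spaceTime hn hb₀ hb₁ hb hfc hψ hpin hbr
  exact ⟨G, hGc, hGeq⟩


/-- **The transposed structure function `ψ = F̃(t, v₂, x₂)` near a point with `∇_h v₂ ≠ 0`.**  Same setting as
`exists_verticalVelocity_eq_structureFunction`; if `∂₀v₂(t₀,y₀) ≠ 0` or `∂₁v₂(t₀,y₀) ≠ 0`, then
`ψ t y = F̃ (t, v t y 2, y₂)` for all `(t,y)` near `(t₀,y₀)`, `F̃ : ℝ × ℝ × ℝ → ℝ` of class `Cⁿ` at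
`(t₀, v t₀ y₀ 2, (y₀)₂)` (the frozen constraint read the other way; `Λ = 1/∂_q F̃`). -/
theorem exists_clebsch_eq_structureFunction {n : WithTop ℕ∞} (hn : n ≠ 0)
    (hrate : HasTypeITimeDecay C v)
    (hcont : ContinuousOn (uncurry v) (Iio (0 : ℝ) ×ˢ univ))
    (hmild : ∀ s t : ℝ, s < t → t < 0 → ∀ x,
      v t x = UnboundedOperators.heatExtension (v s) (t - s) x - oseenDuhamel 1 s v v t x)
    (hdiv : ∀ t < 0, VectorCalculus.IsDivFree (v t))
    (hpol : ∀ s < 0, ∀ y, ⟪curl (v s) y, EuclideanSpace.single 2 1⟫_ℝ = 0)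
    {ψ : ℝ → EuclideanSpace ℝ (Fin 3) → ℝ} {t₀ : ℝ} {y₀ : EuclideanSpace ℝ (Fin 3)} (ht₀ : t₀ < 0)
    (hψ : ContDiffAt ℝ n (uncurry ψ) (t₀, y₀))
    (hω : ∀ t < 0, ∀ y, curl (v t) y 0 = fderiv ℝ (ψ t) y (EuclideanSpace.single 1 1) ∧
      curl (v t) y 1 = -fderiv ℝ (ψ t) y (EuclideanSpace.single 0 1))
    (hne : fderiv ℝ (v t₀) y₀ (EuclideanSpace.single 0 1) 2 ≠ 0 ∨
      fderiv ℝ (v t₀) y₀ (EuclideanSpace.single 1 1) 2 ≠ 0) :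
    ∃ F : ℝ × ℝ × ℝ → ℝ, ContDiffAt ℝ n F (t₀, v t₀ y₀ 2, y₀ 2) ∧
      ∀ᶠ z in 𝓝 (t₀, y₀), ψ z.1 z.2 = F (z.1, v z.1 z.2 2, z.2 2) := by
  have hn1 : (1 : WithTop ℕ∞) ≤ n := ENat.one_le_iff_ne_zero_withTop.mpr hn
  have hanV := analyticOnNhd_uncurry hcont (bdd_of_hasTypeITimeDecay hrate) hmild
  have hmem : (t₀, y₀) ∈ Iio (0 : ℝ) ×ˢ (univ : Set (EuclideanSpace ℝ (Fin 3))) :=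
    mem_prod.2 ⟨show t₀ < 0 from ht₀, mem_univ _⟩
  have hslab : Iio (0 : ℝ) ×ˢ (univ : Set (EuclideanSpace ℝ (Fin 3))) ∈ 𝓝 (t₀, y₀) :=
    (isOpen_Iio.prod isOpen_univ).mem_nhds hmem
  set g : ℝ × EuclideanSpace ℝ (Fin 3) → ℝ := fun p => v p.1 p.2 2 with hg
  have hgc : ContDiffAt ℝ n g (t₀, y₀) := by
    have h1 : ContDiffAt ℝ n (uncurry v) (t₀, y₀) := (hanV _ hmem).contDiffAt
    exact ((EuclideanSpace.proj (2 : Fin 3) : EuclideanSpace ℝ (Fin 3) →L[ℝ] ℝ).contDiff.contDiffAt).comp _ h1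
  -- the pin
  obtain ⟨b₀, b₁, hb₀, hb₁, hb, hpin0⟩ : ∃ b₀ b₁ : Fin 3, b₀ ≠ 2 ∧ b₁ ≠ 2 ∧ b₀ ≠ b₁ ∧
      fderiv ℝ (v t₀) y₀ (EuclideanSpace.single b₀ 1) 2 ≠ 0 := by
    rcases hne with h0 | h1
    · exact ⟨0, 1, by decide, by decide, by decide, h0⟩
    · exact ⟨1, 0, by decide, by decide, by decide, h1⟩
  have hψd : ∀ᶠ z in 𝓝 (t₀, y₀), DifferentiableAt ℝ (uncurry ψ) z :=
    ((hψ.of_le hn1).eventually (by simp)).mono fun z hz => hz.differentiableAt one_ne_zero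
  have hvd : ∀ᶠ z in 𝓝 (t₀, y₀), DifferentiableAt ℝ (uncurry v) z ∧ z.1 < 0 := by
    filter_upwards [hslab] with z hz
    exact ⟨(hanV z hz).differentiableAt, (mem_prod.1 hz).1⟩
  have hpin : fderiv ℝ g (t₀, y₀) ((0 : ℝ), EuclideanSpace.single b₀ (1 : ℝ)) ≠ 0 := by
    rw [hg, fderiv_uncurry_apply_two_zero_dir (hanV _ hmem).differentiableAt]
    exact hpin0
  have hbr : ∀ᶠ z in 𝓝 (t₀, y₀),
      fderiv ℝ (uncurry ψ) z ((0 : ℝ), EuclideanSpace.single b₀ (1 : ℝ)) *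
          fderiv ℝ g z ((0 : ℝ), EuclideanSpace.single b₁ (1 : ℝ)) =
        fderiv ℝ (uncurry ψ) z ((0 : ℝ), EuclideanSpace.single b₁ (1 : ℝ)) *
          fderiv ℝ g z ((0 : ℝ), EuclideanSpace.single b₀ (1 : ℝ)) := by
    filter_upwards [hψd, hvd] with z hzψ hzv
    obtain ⟨t, y⟩ := z
    obtain ⟨hzv, ht⟩ := hzv
    rw [fderiv_uncurry_zero_dir hzψ, fderiv_uncurry_zero_dir hzψ, hg,
      fderiv_uncurry_apply_two_zero_dir hzv, fderiv_uncurry_apply_two_zero_dir hzv]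
    have hfro := frozen_bracket (v := v)
      (stub_firstIntegral C v hrate hcont hmild hdiv (EuclideanSpace.single 2 1) hpol t ht)
      (ψ := ψ t) (fun y' => ⟨(hω t ht y').1, (hω t ht y').2, by
        simpa [EuclideanSpace.inner_single_right] using hpol t ht y'⟩) y
    have hcases : (b₀ = 0 ∧ b₁ = 1) ∨ (b₀ = 1 ∧ b₁ = 0) := by
      revert hb₀ hb₁ hb
      clear hpin hpin0
      revert b₀ b₁
      decide
    rcases hcases with ⟨rfl, rfl⟩ | ⟨rfl, rfl⟩
    · linarith
    · linarith
  obtain ⟨G, hGc, hGeq⟩ := exists_comp_spaceTime hn hb₀ hb₁ hb hψ hgc hpin hbr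
  exact ⟨G, hGc, hGeq⟩

/-- **The structure function in `q`-COORDINATES, `ψ = A₁(t, q, x₂)` with `q := v₂ − ψ = ∂₂φ` (K2P1-LOCAL-NOTES §1(e):
"where `Λ ≠ 1` the map `W ↦ q` is invertible on each `(z,t)`: `W = A_q(q,z,t)`", so that `v = (∂₀φ, ∂₁φ, q + A_q(q,z,t))`).**
Same setting as `exists_verticalVelocity_eq_structureFunction`; the pin is now `∂_b(v₂ − ψ)(t₀,·)(y₀) ≠ 0` for a
horizontal `b` — for the Clebsch pair (`v₂ − ψ = ∂₂φ`, `∂_bφ = v_b`) this is the non-degeneracy `∂₂v_b(t₀,y₀) ≠ 0` of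
the registered stub.  Then `ψ t y = A (t, v t y 2 − ψ t y, y₂)` for all `(t,y)` near `(t₀,y₀)`, with `A : ℝ × ℝ × ℝ → ℝ`
of class `Cⁿ` at `(t₀, v t₀ y₀ 2 − ψ t₀ y₀, (y₀)₂)` (the bracket `{ψ, v₂ − ψ}_h = {ψ, v₂}_h = 0`). -/
theorem exists_clebsch_eq_structureFunction_q {n : WithTop ℕ∞} (hn : n ≠ 0)
    (hrate : HasTypeITimeDecay C v)
    (hcont : ContinuousOn (uncurry v) (Iio (0 : ℝ) ×ˢ univ))
    (hmild : ∀ s t : ℝ, s < t → t < 0 → ∀ x,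
      v t x = UnboundedOperators.heatExtension (v s) (t - s) x - oseenDuhamel 1 s v v t x)
    (hdiv : ∀ t < 0, VectorCalculus.IsDivFree (v t))
    (hpol : ∀ s < 0, ∀ y, ⟪curl (v s) y, EuclideanSpace.single 2 1⟫_ℝ = 0)
    {ψ : ℝ → EuclideanSpace ℝ (Fin 3) → ℝ} {t₀ : ℝ} {y₀ : EuclideanSpace ℝ (Fin 3)} (ht₀ : t₀ < 0)
    (hψ : ContDiffAt ℝ n (uncurry ψ) (t₀, y₀))
    (hω : ∀ t < 0, ∀ y, curl (v t) y 0 = fderiv ℝ (ψ t) y (EuclideanSpace.single 1 1) ∧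
      curl (v t) y 1 = -fderiv ℝ (ψ t) y (EuclideanSpace.single 0 1))
    (hne : fderiv ℝ (fun y => v t₀ y 2 - ψ t₀ y) y₀ (EuclideanSpace.single 0 1) ≠ 0 ∨
      fderiv ℝ (fun y => v t₀ y 2 - ψ t₀ y) y₀ (EuclideanSpace.single 1 1) ≠ 0) :
    ∃ A : ℝ × ℝ × ℝ → ℝ, ContDiffAt ℝ n A (t₀, v t₀ y₀ 2 - ψ t₀ y₀, y₀ 2) ∧
      ∀ᶠ z in 𝓝 (t₀, y₀), ψ z.1 z.2 = A (z.1, v z.1 z.2 2 - ψ z.1 z.2, z.2 2) := by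
  have hn1 : (1 : WithTop ℕ∞) ≤ n := ENat.one_le_iff_ne_zero_withTop.mpr hn
  have hanV := analyticOnNhd_uncurry hcont (bdd_of_hasTypeITimeDecay hrate) hmild
  have hmem : (t₀, y₀) ∈ Iio (0 : ℝ) ×ˢ (univ : Set (EuclideanSpace ℝ (Fin 3))) :=
    mem_prod.2 ⟨show t₀ < 0 from ht₀, mem_univ _⟩
  have hslab : Iio (0 : ℝ) ×ˢ (univ : Set (EuclideanSpace ℝ (Fin 3))) ∈ 𝓝 (t₀, y₀) :=
    (isOpen_Iio.prod isOpen_univ).mem_nhds hmem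
  set w : ℝ × EuclideanSpace ℝ (Fin 3) → ℝ := fun p => v p.1 p.2 2 with hw
  have hwc : ContDiffAt ℝ n w (t₀, y₀) := by
    have h1 : ContDiffAt ℝ n (uncurry v) (t₀, y₀) := (hanV _ hmem).contDiffAt
    exact ((EuclideanSpace.proj (2 : Fin 3) : EuclideanSpace ℝ (Fin 3) →L[ℝ] ℝ).contDiff.contDiffAt).comp _ h1
  set g : ℝ × EuclideanSpace ℝ (Fin 3) → ℝ := fun p => w p - uncurry ψ p with hg
  have hgc : ContDiffAt ℝ n g (t₀, y₀) := hwc.sub hψ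
  -- slice form of `g` and of its horizontal partials
  have hgslice : ∀ t, (fun y => v t y 2 - ψ t y) = fun y => g (t, y) := fun t => rfl
  have hDg : ∀ p : ℝ × EuclideanSpace ℝ (Fin 3), DifferentiableAt ℝ (uncurry v) p →
      DifferentiableAt ℝ (uncurry ψ) p → ∀ e : EuclideanSpace ℝ (Fin 3),
      fderiv ℝ g p ((0 : ℝ), e) = fderiv ℝ (v p.1) p.2 e 2 - fderiv ℝ (ψ p.1) p.2 e := by
    rintro ⟨t, y⟩ hv hψ' e
    have hwd : DifferentiableAt ℝ w (t, y) :=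
      ((EuclideanSpace.proj (2 : Fin 3) : EuclideanSpace ℝ (Fin 3) →L[ℝ] ℝ).differentiableAt).comp _ hv
    rw [hg, fderiv_fun_sub hwd hψ', sub_apply, hw, fderiv_uncurry_apply_two_zero_dir hv,
      fderiv_uncurry_zero_dir hψ']
  have hDg_slice : ∀ p : ℝ × EuclideanSpace ℝ (Fin 3), DifferentiableAt ℝ (uncurry v) p →
      DifferentiableAt ℝ (uncurry ψ) p → ∀ e : EuclideanSpace ℝ (Fin 3),
      fderiv ℝ (fun y => v p.1 y 2 - ψ p.1 y) p.2 e = fderiv ℝ g p ((0 : ℝ), e) := by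
    rintro ⟨t, y⟩ hv hψ' e
    have hgd : DifferentiableAt ℝ g (t, y) :=
      (((EuclideanSpace.proj (2 : Fin 3) : EuclideanSpace ℝ (Fin 3) →L[ℝ] ℝ).differentiableAt).comp _ hv).sub hψ'
    rw [hgslice t]
    exact (fderiv_uncurry_zero_dir (ψ := fun t y => g (t, y)) hgd e).symm
  -- the pin
  obtain ⟨b₀, b₁, hb₀, hb₁, hb, hpin0⟩ : ∃ b₀ b₁ : Fin 3, b₀ ≠ 2 ∧ b₁ ≠ 2 ∧ b₀ ≠ b₁ ∧
      fderiv ℝ (fun y => v t₀ y 2 - ψ t₀ y) y₀ (EuclideanSpace.single b₀ 1) ≠ 0 := by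
    rcases hne with h0 | h1
    · exact ⟨0, 1, by decide, by decide, by decide, h0⟩
    · exact ⟨1, 0, by decide, by decide, by decide, h1⟩
  have hψd : ∀ᶠ z in 𝓝 (t₀, y₀), DifferentiableAt ℝ (uncurry ψ) z :=
    ((hψ.of_le hn1).eventually (by simp)).mono fun z hz => hz.differentiableAt one_ne_zero
  have hvd : ∀ᶠ z in 𝓝 (t₀, y₀), DifferentiableAt ℝ (uncurry v) z ∧ z.1 < 0 := by
    filter_upwards [hslab] with z hz
    exact ⟨(hanV z hz).differentiableAt, (mem_prod.1 hz).1⟩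
  have hpin : fderiv ℝ g (t₀, y₀) ((0 : ℝ), EuclideanSpace.single b₀ (1 : ℝ)) ≠ 0 := by
    rw [← hDg_slice (t₀, y₀) (hanV _ hmem).differentiableAt (hψ.differentiableAt hn)]
    exact hpin0
  have hbr : ∀ᶠ z in 𝓝 (t₀, y₀),
      fderiv ℝ (uncurry ψ) z ((0 : ℝ), EuclideanSpace.single b₀ (1 : ℝ)) *
          fderiv ℝ g z ((0 : ℝ), EuclideanSpace.single b₁ (1 : ℝ)) =
        fderiv ℝ (uncurry ψ) z ((0 : ℝ), EuclideanSpace.single b₁ (1 : ℝ)) *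
          fderiv ℝ g z ((0 : ℝ), EuclideanSpace.single b₀ (1 : ℝ)) := by
    filter_upwards [hψd, hvd] with z hzψ hzv
    obtain ⟨hzv, ht⟩ := hzv
    rw [hDg z hzv hzψ, hDg z hzv hzψ]
    obtain ⟨t, y⟩ := z
    rw [fderiv_uncurry_zero_dir hzψ, fderiv_uncurry_zero_dir hzψ]
    have hfro := frozen_bracket (v := v)
      (stub_firstIntegral C v hrate hcont hmild hdiv (EuclideanSpace.single 2 1) hpol t ht)
      (ψ := ψ t) (fun y' => ⟨(hω t ht y').1, (hω t ht y').2, by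
        simpa [EuclideanSpace.inner_single_right] using hpol t ht y'⟩) y
    have hcases : (b₀ = 0 ∧ b₁ = 1) ∨ (b₀ = 1 ∧ b₁ = 0) := by
      revert hb₀ hb₁ hb
      clear hpin hpin0
      revert b₀ b₁
      decide
    rcases hcases with ⟨rfl, rfl⟩ | ⟨rfl, rfl⟩
    · linear_combination (-1 : ℝ) * hfro
    · linear_combination hfro
  obtain ⟨G, hGc, hGeq⟩ := exists_comp_spaceTime hn hb₀ hb₁ hb hψ hgc hpin hbr
  exact ⟨G, hGc, hGeq⟩

/-- **The Clebsch pair of a poloidal profile WITH its local structure functions (packaged).**  For a profile of the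
route's Type-I class, poloidal along `e₃`, there are `φ ψ : ℝ → ℝ³ → ℝ`, jointly `C^∞` on the slab `(−∞,0) × ℝ³`, with
`v t = ∇(φ t) + (ψ t) e₂`, `v₂ = ∂₂φ + ψ`, `curl (v t) = (∂₁ψ, −∂₀ψ, 0)` and (E1) `Δφ + ∂₂ψ = 0` on every slice (tree
`…Clebsch.exists_clebsch_uncurry`), AND near every point `(t₀, y₀)` of the slab where the vorticity does not vanish a
`C^∞` structure function: `v t y 2 = F (t, ψ t y, y₂)` for `(t,y)` near `(t₀,y₀)`, `F : ℝ × ℝ × ℝ → ℝ` of class `C^∞`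
at `(t₀, ψ t₀ y₀, (y₀)₂)` (K2P1-LOCAL-NOTES §1(a)–(d)). -/
theorem exists_clebsch_structureFunction (hrate : HasTypeITimeDecay C v)
    (hcont : ContinuousOn (uncurry v) (Iio (0 : ℝ) ×ˢ univ))
    (hmild : ∀ s t : ℝ, s < t → t < 0 → ∀ x,
      v t x = UnboundedOperators.heatExtension (v s) (t - s) x - oseenDuhamel 1 s v v t x)
    (hdiv : ∀ t < 0, VectorCalculus.IsDivFree (v t))
    (hpol : ∀ s < 0, ∀ y, ⟪curl (v s) y, EuclideanSpace.single 2 1⟫_ℝ = 0) :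
    ∃ φ ψ : ℝ → EuclideanSpace ℝ (Fin 3) → ℝ,
      ContDiffOn ℝ ∞ (uncurry φ) (Iio (0 : ℝ) ×ˢ univ) ∧ ContDiffOn ℝ ∞ (uncurry ψ) (Iio (0 : ℝ) ×ˢ univ) ∧
      (∀ t < 0,
        (∀ y, v t y = gradient (φ t) y + ψ t y • EuclideanSpace.single 2 1) ∧
        (∀ y, v t y 2 = fderiv ℝ (φ t) y (EuclideanSpace.single 2 1) + ψ t y) ∧
        (∀ y, curl (v t) y 0 = fderiv ℝ (ψ t) y (EuclideanSpace.single 1 1) ∧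
          curl (v t) y 1 = -fderiv ℝ (ψ t) y (EuclideanSpace.single 0 1) ∧ curl (v t) y 2 = 0) ∧
        (∀ y, (Δ (φ t)) y + fderiv ℝ (ψ t) y (EuclideanSpace.single 2 1) = 0)) ∧
      ∀ t₀ < 0, ∀ y₀ : EuclideanSpace ℝ (Fin 3), curl (v t₀) y₀ ≠ 0 →
        ∃ F : ℝ × ℝ × ℝ → ℝ, ContDiffAt ℝ ∞ F (t₀, ψ t₀ y₀, y₀ 2) ∧
          ∀ᶠ z in 𝓝 (t₀, y₀), v z.1 z.2 2 = F (z.1, ψ z.1 z.2, z.2 2) := by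
  obtain ⟨φ, ψ, hφs, hψs, hall⟩ := exists_clebsch_uncurry hrate hcont hmild hdiv hpol
  refine ⟨φ, ψ, hφs, hψs, fun t ht => ⟨(hall t ht).2.2.2.1, (hall t ht).2.2.1, (hall t ht).2.2.2.2.1,
    (hall t ht).2.2.2.2.2⟩, fun t₀ ht₀ y₀ hne => ?_⟩
  have hmem : (t₀, y₀) ∈ Iio (0 : ℝ) ×ˢ (univ : Set (EuclideanSpace ℝ (Fin 3))) :=
    mem_prod.2 ⟨show t₀ < 0 from ht₀, mem_univ _⟩
  have hψ : ContDiffAt ℝ ∞ (uncurry ψ) (t₀, y₀) :=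
    hψs.contDiffAt ((isOpen_Iio.prod isOpen_univ).mem_nhds hmem)
  exact exists_verticalVelocity_eq_structureFunction (by simp) hrate hcont hmild hdiv hpol ht₀ hψ
    (fun t ht y => ⟨((hall t ht).2.2.2.2.1 y).1, ((hall t ht).2.2.2.2.1 y).2.1⟩) hne

end Summit.NavierStokesRegularity.NavierStokesRegularity.Theorems.PoloidalWindowDoorPoloidalWindowRigidityStructureFunction

end
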